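import Literature.AnabelianGeometry.SemiGraphs.TemperedCurves
import Literature.AnabelianGeometry.SemiGraphs.TemperedDecompositionCompact
import Literature.AnabelianGeometry.AbsoluteAnabelian.MLFSlimKummerProofs
import Literature.NumberTheory.GaloisRepresentations.LocalFieldCountableExtensions
import Literature.NumberTheory.GaloisRepresentations.LocalFieldPadicProofs
import Mathlib.Topology.Algebra.ClopenNhdofOne
import HarnessLib

/-!
# `G_{ℚ_p}` is Galois-countable, and an ARITHMETICALLY GENUINE inhabitant of the L3 interface
# `TemperedArithmeticGroup ℚ_p` ([SemiAnbd] Ex. 3.10; [IUTchI] Rmk. 2.5.3 (i)(ii))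

Mochizuki, *Semi-graphs of anabelioids*, Publ. RIMS **42** (2006) [SemiAnbd], Example 3.10 pp. 43–45
("`1 → Δ → Π → G_K → 1`", "`Π` [is] temp-slim"); *Inter-universal Teichmüller theory I*, Rmk. 2.5.3 (i)
(T1) p. 52 ("Galois-countable": "its topology admits a countable basis"), (ii) (E1)–(E2) p. 53. abc-iut
cell, wave-5 prover seat abc-iut-w5-d218 (gen 2); VACUITY LANE (L3 interface `TemperedArithmeticGroup`,
`TemperedCurves.lean`). PROOF-ONLY (no definition, no instance, no named fact).

* `secondCountableTopology_of_countable_openSubgroup` — a profinite group with countably many open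
  subgroups is second countable (the cosets of the open subgroups form a countable basis);
* `secondCountableTopology_absoluteGaloisGroup_of_isNonarchimedeanLocalField` — for a non-archimedean
  local field `F` of characteristic `0`, `G_F = Gal(F̄/F)` is second countable ("Galois-countable"), from the
  tree's `countable_openSubgroup_of_isNonarchimedeanLocalField` (Krasner: countably many finite
  subextensions); `secondCountableTopology_absoluteGaloisGroup_padic` — the case `F = ℚ_p` (the
  UNCOUNTABLE-base case: the tree's `Rmk253.secondCountableTopology_absoluteGaloisGroup` needs `K`
  countable);
* `TemperedArithmeticGroup.nonempty_model_padic` — **a kernel inhabitant of `TemperedArithmeticGroup ℚ_p`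
  with the GENUINE arithmetic quotient**: `Π := G_{ℚ_p}` with the identity augmentation (so `Δ = 1`:
  geometrically DEGENERATE — honest label), tempered (profinite, `IsTempered.of_profinite`), SLIM by the
  tree's THEOREM `galoisMLF_slim_holds` ([AbsAnab] Thm 1.1.1 (ii) for MLFs, abc-iut-L4), second countable
  by the above. Complements `TemperedCurvesWitness` (abc-iut-c312-4: `K` algebraically closed, `G_K = 1`)
  and `OncePuncturedTemperedGroupWitness` (abc-iut-w5-d218: genuine geometric part, `G_K = 1`).
HONEST FRAMING: consistency evidence for the axiom package only; `G_{ℚ_p}` with `Δ = 1` is not the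
tempered fundamental group of a curve; nothing of [SemiAnbd]/[IUTchI] is asserted; no side is taken on
[IUTchIII] Cor. 3.12.
-/

noncomputable section

open Topology TopologicalSpace Filter Set Function
open Literature.AlgebraicGeometry.Frobenioids (IsSlimGroup)

universe u

namespace Literature.AnabelianGeometry.SemiGraphs

/-! ### Countably many open subgroups ⇒ second countable (profinite groups) -/

/-- **A profinite group with countably many open subgroups is second countable**: the cosets `gU`,
`U` an open subgroup (finitely many for each `U`), are open and form a basis of the topology, since the
open (normal) subgroups form a basis of neighbourhoods of `1`
(`ProfiniteGrp.exist_openNormalSubgroup_sub_open_nhds_of_one`). ([IUTchI] Rmk. 2.5.3 (i) (T1)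
"Galois-countable".) [cite: MochizukiSemiAnbd2006, Rmk 3.1.1 p.33] -/
theorem secondCountableTopology_of_countable_openSubgroup {G : Type u} [Group G] [TopologicalSpace G]
    [IsTopologicalGroup G] [CompactSpace G] [TotallyDisconnectedSpace G] [Countable (OpenSubgroup G)] :
    SecondCountableTopology G := by
  classical
  -- the basis: fibres of the quotient maps `G → G/U`, `U` open
  let B : Set (Set G) :=
    ⋃ U : OpenSubgroup G, Set.range fun q : G ⧸ U.toSubgroup => (QuotientGroup.mk ⁻¹' {q} : Set G)
  have hBc : B.Countable := by
    refine Set.countable_iUnion fun U => ?_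
    haveI : Finite (G ⧸ U.toSubgroup) := inferInstance
    exact (Set.finite_range _).countable
  have hBopen : ∀ s ∈ B, IsOpen s := by
    intro s hs
    obtain ⟨U, hU⟩ := Set.mem_iUnion.mp hs
    obtain ⟨q, rfl⟩ := hU
    exact (isOpen_discrete {q}).preimage
      (QuotientGroup.continuous_mk (N := U.toSubgroup))
  have hB : IsTopologicalBasis B := by
    refine isTopologicalBasis_of_isOpen_of_nhds hBopen ?_
    intro x O hxO hO
    -- an open normal subgroup `V` with `x • V ⊆ O`
    have hO' : IsOpen ((fun y : G => x * y) ⁻¹' O) := hO.preimage (continuous_const.mul continuous_id)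
    obtain ⟨V, hV⟩ := ProfiniteGrp.exist_openNormalSubgroup_sub_open_nhds_of_one hO' (by simpa using hxO)
    refine ⟨QuotientGroup.mk ⁻¹' {(QuotientGroup.mk x : G ⧸ V.toSubgroup)}, ?_, rfl, ?_⟩
    · exact Set.mem_iUnion.mpr ⟨V.toOpenSubgroup, ⟨_, rfl⟩⟩
    · intro y hy
      have hy' : (QuotientGroup.mk y : G ⧸ V.toSubgroup) = QuotientGroup.mk x := hy
      have hxy : x⁻¹ * y ∈ V.toSubgroup := QuotientGroup.eq.mp hy'.symm
      have := hV hxy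
      simpa using this
  exact hB.secondCountableTopology hBc

/-! ### `G_F` is Galois-countable for a non-archimedean local field `F` -/

/-- **The absolute Galois group of a non-archimedean local field of characteristic `0` is second
countable** ("Galois-countable", [IUTchI] Rmk. 2.5.3 (i) (T1) / (ii)): it is profinite with countably
many open subgroups (tree `countable_openSubgroup_of_isNonarchimedeanLocalField`, via Krasner's lemma:
countably many finite subextensions of `F̄/F`). [cite: MochizukiSemiAnbd2006, Ex 3.10 p.43] -/
theorem secondCountableTopology_absoluteGaloisGroup_of_isNonarchimedeanLocalField (F : Type)
    [Field F] [ValuativeRel F] [TopologicalSpace F] [IsNonarchimedeanLocalField F] [CharZero F] :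
    SecondCountableTopology (Field.absoluteGaloisGroup F) := by
  haveI : IsGalois F (AlgebraicClosure F) := {}
  haveI : CompactSpace (Field.absoluteGaloisGroup F) := by
    change CompactSpace (AlgebraicClosure F ≃ₐ[F] AlgebraicClosure F); infer_instance
  haveI : T2Space (Field.absoluteGaloisGroup F) := krullTopology_t2
  haveI : TotallyDisconnectedSpace (Field.absoluteGaloisGroup F) := by
    change TotallyDisconnectedSpace (AlgebraicClosure F ≃ₐ[F] AlgebraicClosure F); infer_instance
  haveI : Countable (OpenSubgroup (Field.absoluteGaloisGroup F)) :=
    Literature.NumberTheory.GaloisRepresentations.countable_openSubgroup_of_isNonarchimedeanLocalField F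
  exact secondCountableTopology_of_countable_openSubgroup

/-- **`G_{ℚ_p}` is Galois-countable**: `SecondCountableTopology (Gal(Q̄_p/ℚ_p))` — the uncountable-base
case of [IUTchI] Rmk. 2.5.3 (ii) (E1) for MLFs (Mathlib's `ValuativeRel ℚ_[p]`; the tree's
`Padic.isValuativeTopology` makes `ℚ_p` a non-archimedean local field).
[cite: MochizukiSemiAnbd2006, Ex 3.10 p.43] -/
theorem secondCountableTopology_absoluteGaloisGroup_padic (p : ℕ) [Fact p.Prime] :
    SecondCountableTopology (Field.absoluteGaloisGroup ℚ_[p]) := by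
  haveI := Literature.NumberTheory.GaloisRepresentations.Padic.isValuativeTopology p
  haveI : IsNonarchimedeanLocalField ℚ_[p] := {}
  exact secondCountableTopology_absoluteGaloisGroup_of_isNonarchimedeanLocalField ℚ_[p]

/-! ### The arithmetically genuine inhabitant of `TemperedArithmeticGroup ℚ_p` -/

/-- **Kernel inhabitant of `TemperedArithmeticGroup ℚ_p` with the GENUINE arithmetic quotient**
([SemiAnbd] Ex. 3.10 as typed in `TemperedCurves.lean`): `Π := G_{ℚ_p} = Gal(Q̄_p/ℚ_p)` with the
identity augmentation — tempered (profinite), SLIM (tree theorem `galoisMLF_slim_holds`: absolute Galois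
groups of MLFs are slim), Galois-countable (`secondCountableTopology_absoluteGaloisGroup_padic`); the
geometric part `Δ = Ker(id) = 1` is DEGENERATE (trivially tempered and slim). Consistency evidence for
the axiom package with a non-trivial `G_K`; not the tempered fundamental group of a curve.
[cite: MochizukiSemiAnbd2006, Ex 3.10 pp.43-45] -/
theorem TemperedArithmeticGroup.nonempty_model_padic (p : ℕ) [Fact p.Prime] :
    Nonempty (TemperedArithmeticGroup ℚ_[p]) := by
  haveI : IsGalois ℚ_[p] (AlgebraicClosure ℚ_[p]) := {}
  haveI : CompactSpace (Field.absoluteGaloisGroup ℚ_[p]) := by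
    change CompactSpace (AlgebraicClosure ℚ_[p] ≃ₐ[ℚ_[p]] AlgebraicClosure ℚ_[p]); infer_instance
  haveI : T2Space (Field.absoluteGaloisGroup ℚ_[p]) := krullTopology_t2
  haveI : TotallyDisconnectedSpace (Field.absoluteGaloisGroup ℚ_[p]) := by
    change TotallyDisconnectedSpace (AlgebraicClosure ℚ_[p] ≃ₐ[ℚ_[p]] AlgebraicClosure ℚ_[p])
    infer_instance
  have hT : IsTempered (Field.absoluteGaloisGroup ℚ_[p]) := IsTempered.of_profinite
  have hSlim : IsSlimGroup (Field.absoluteGaloisGroup ℚ_[p]) :=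
    Literature.AnabelianGeometry.AbsoluteAnabelian.galoisMLF_slim_holds p ℚ_[p]
  let aug : Field.absoluteGaloisGroup ℚ_[p] →ₜ* Field.absoluteGaloisGroup ℚ_[p] :=
    ContinuousMonoidHom.id _
  -- the kernel `Δ = 1`
  have hker : ∀ g : Field.absoluteGaloisGroup ℚ_[p], g ∈ aug.toMonoidHom.ker ↔ g = 1 := fun g =>
    MonoidHom.mem_ker
  haveI hsub : Subsingleton aug.toMonoidHom.ker :=
    ⟨fun a b => Subtype.ext (((hker _).mp a.2).trans ((hker _).mp b.2).symm)⟩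
  have hkerClosed : IsClosed (aug.toMonoidHom.ker : Set (Field.absoluteGaloisGroup ℚ_[p])) := by
    rw [MonoidHom.coe_ker]
    exact isClosed_singleton.preimage (map_continuous aug)
  have hSlimKer : IsSlimGroup aug.toMonoidHom.ker := ⟨fun H _ => Subsingleton.elim _ _⟩
  exact
    ⟨{ Pi := Field.absoluteGaloisGroup ℚ_[p]
       isTempered := hT
       aug := aug
       aug_surjective := fun g => ⟨g, rfl⟩
       isTempered_ker := hT.subgroup_of_isClosed _ hkerClosed
       isSlimGroup := hSlim
       isSlimGroup_ker := hSlimKer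
       secondCountableTopology := secondCountableTopology_absoluteGaloisGroup_padic p }⟩

end Literature.AnabelianGeometry.SemiGraphs

end
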